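import Summits.AtomisticToContinuum.HydrodynamicLimit.Theorems.KineticFluxLdDecay.Negative.TiltWitnessCalc
import HarnessLib

/-!
# Gibbs tilts are unprofitable at small amplitude

Crux `Summit.AtomisticToContinuum.HydrodynamicLimit.Theses.AntiMazurCoboundaries.KineticFluxLdDecay`
(stmt-AtomisticToContinuum-10967), line `self-tilted-edge-covariance`: this is the FIRST SUPPORT LEMMA
("shell-sector / Gibbs-tilt unprofitability") of the open stub `stub_tiltedThirdCumulantSublinear`, and it
DISCHARGES the near-miss left as `sorry` by the standing disprover,
`Cruxes/KineticFluxLdDecay/Disproof.lean § 4, tiltFunctional_nonpos_of_admissible` (same statement, with the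
Disproof's `Orthogonal g` and `tiltFunctional` unfolded; absolute amplitude `κ₀ = 1/4`).

**Statement.** Let `γ = stdGaussian V3`, `g : V3 → ℝ` continuous with `|g| ≤ 1/4` and
`g ⊥ span{1, v, |v|²}` in `L²(γ)`. Then for every drift `u₁` and temperature `θ₁ > 0` the Gibbs-tilt functional
`Γ(g; u₁, θ₁) = ∫ (g + llr1 θ₁ u₁)(u₁ + √θ₁ w) dγ(w) = E_{N(u₁,θ₁)} g − KL(N(u₁,θ₁) ‖ N(0,1))` is `≤ 0`
(`tiltFunctional_nonpos_of_abs_le_quarter`, `tiltFunctional_nonpos_of_admissible`).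

**Proof.** With `L := llr1 θ₁ u₁ = log (dγ/dN(u₁,θ₁))` (`TiltBasics.llr1_eq`):
* COST `∫ L(u₁ + √θ₁ w) dγ = −A`, `A := ‖u₁‖²/2 + (3/2)(θ₁ − 1 − log θ₁)` (`integral_llr1_comp_shift`);
* GAIN `G := ∫ g(u₁ + √θ₁ w) dγ = ∫ g e^{−L} dγ` (`integral_comp_shift_eq_integral_mul_exp_neg_llr1`: the tilted
  Gaussian has density `localMaxwellian 1 θ₁ u₁ = globalMaxwellian · e^{−L}`), `∫ e^{−L} dγ = 1`;
* ORTHOGONALITY: `1 − L ∈ span{1, v, |v|²}`, so `∫ g (1 − L) dγ = 0` and `G = ∫ g (e^{−L} − 1 + L) dγ` with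
  `e^{−L} − 1 + L ≥ 0`, whence `G ≤ (1/4) ∫ (e^{−L} − 1 + L) dγ = B/4`,
  `B := ∫ L dγ = KL(N(0,1) ‖ N(u₁,θ₁)) = ‖u₁‖²/(2θ₁) + (3/2)(θ₁⁻¹ − 1 + log θ₁)` (`integral_llr1_stdGaussian`);
  also `G ≤ 1/4` trivially;
* REAL INEQUALITIES: for `θ₁ ≤ 1/2`, `A ≥ (3/2)(log 2 − 1/2) > 1/4 ≥ G`; for `θ₁ ≥ 1/2`, `B ≤ 2A` by
  `(θ + 1) log θ ≤ 2(θ − 1)` on `(0, 1]` (`add_one_mul_log_le`) and `2 log θ ≤ θ − θ⁻¹` on `[1, ∞)`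
  (`two_mul_log_le`), so `G ≤ B/4 ≤ A/2 ≤ A`.
-/

noncomputable section

open MeasureTheory ProbabilityTheory
open scoped InnerProductSpace
open Literature.Analysis.FluidPDE Literature.MathematicalPhysics.KineticTheory

namespace Summit.AtomisticToContinuum.HydrodynamicLimit.Theorems
namespace KineticFluxLdDecayTilt

/-! ### Two classical logarithm inequalities -/

/-- `(θ + 1) log θ ≤ 2 (θ - 1)` on `(0, 1]` (equivalently `artanh s ≥ s`, `s = (1 - θ)/(1 + θ)`):
`x ↦ 2 (x - 1) - (x + 1) log x` has derivative `1 - x⁻¹ - log x ≤ 0` and vanishes at `1`. [folklore] -/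
theorem add_one_mul_log_le {θ : ℝ} (hθ : 0 < θ) (hθ1 : θ ≤ 1) :
    (θ + 1) * Real.log θ ≤ 2 * (θ - 1) := by
  have hd : ∀ x : ℝ, 0 < x → HasDerivAt (fun x : ℝ => 2 * (x - 1) - (x + 1) * Real.log x)
      (1 - x⁻¹ - Real.log x) x := by
    intro x hx
    have h : HasDerivAt (fun x : ℝ => 2 * (x - 1) - (x + 1) * Real.log x)
        (2 * 1 - (1 * Real.log x + (x + 1) * x⁻¹)) x :=
      (((hasDerivAt_id x).sub_const 1).const_mul 2).sub
        (((hasDerivAt_id x).add_const 1).mul (Real.hasDerivAt_log hx.ne'))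
    exact h.congr_deriv (by field_simp; ring)
  have hanti : AntitoneOn (fun x : ℝ => 2 * (x - 1) - (x + 1) * Real.log x) (Set.Ioi 0) := by
    refine antitoneOn_of_hasDerivWithinAt_nonpos (f' := fun x => 1 - x⁻¹ - Real.log x) (convex_Ioi 0)
      (fun x hx => (hd x hx).continuousAt.continuousWithinAt) ?_ ?_
    · intro x hx
      rw [interior_Ioi] at hx ⊢
      exact (hd x hx).hasDerivWithinAt
    · intro x hx
      rw [interior_Ioi] at hx
      have := Real.one_sub_inv_le_log_of_pos (Set.mem_Ioi.1 hx)
      linarith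
  have h := hanti (Set.mem_Ioi.2 hθ) (Set.mem_Ioi.2 one_pos) hθ1
  simp only [Real.log_one, mul_zero, sub_self] at h
  linarith

/-- `2 log θ ≤ θ - θ⁻¹` on `[1, ∞)`: `x ↦ x - x⁻¹ - 2 log x` has derivative `(1 - x⁻¹)² ≥ 0` and vanishes
at `1`. [folklore] -/
theorem two_mul_log_le {θ : ℝ} (hθ : 1 ≤ θ) : 2 * Real.log θ ≤ θ - θ⁻¹ := by
  have hd : ∀ x : ℝ, 0 < x → HasDerivAt (fun x : ℝ => x - x⁻¹ - 2 * Real.log x)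
      ((1 - x⁻¹) ^ 2) x := by
    intro x hx
    have h : HasDerivAt (fun x : ℝ => x - x⁻¹ - 2 * Real.log x)
        (1 - -(x ^ 2)⁻¹ - 2 * x⁻¹) x :=
      ((hasDerivAt_id x).sub (hasDerivAt_inv hx.ne')).sub
        ((Real.hasDerivAt_log hx.ne').const_mul 2)
    exact h.congr_deriv (by field_simp; ring)
  have hmono : MonotoneOn (fun x : ℝ => x - x⁻¹ - 2 * Real.log x) (Set.Ioi 0) := by
    refine monotoneOn_of_hasDerivWithinAt_nonneg (f' := fun x => (1 - x⁻¹) ^ 2) (convex_Ioi 0)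
      (fun x hx => (hd x hx).continuousAt.continuousWithinAt) ?_ ?_
    · intro x hx
      rw [interior_Ioi] at hx ⊢
      exact (hd x hx).hasDerivWithinAt
    · intro x _
      exact sq_nonneg _
  have h := hmono (Set.mem_Ioi.2 one_pos) (Set.mem_Ioi.2 (one_pos.trans_le hθ)) hθ
  simp only [Real.log_one, mul_zero, inv_one, sub_self] at h
  linarith

/-! ### Gaussian identities for the log-likelihood ratio `llr1` -/

/-- `llr1` is integrable under the standard Gaussian. [folklore] -/
theorem integrable_llr1_stdGaussian {θ₁ : ℝ} (hθ₁ : 0 < θ₁) (u₁ : V3) :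
    Integrable (llr1 θ₁ u₁) (stdGaussian V3) := by
  have h3 : Integrable (fun v : V3 => ‖v - u₁‖ ^ 2) (stdGaussian V3) :=
    ((IsGaussian.memLp_id (stdGaussian V3) 2 (by simp)).sub (memLp_const u₁)).integrable_norm_pow
      (by norm_num)
  have : llr1 θ₁ u₁ = fun v => 3 / 2 * Real.log θ₁ - ‖v‖ ^ 2 / 2 + ‖v - u₁‖ ^ 2 / (2 * θ₁) :=
    funext fun v => llr1_eq hθ₁ u₁ v
  rw [this]
  exact ((integrable_const _).sub (integrable_norm_sq_stdGaussian.div_const 2)).add (h3.div_const _)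

/-- `B := ∫ llr1 θ₁ u₁ dγ = KL(N(0,1) ‖ N(u₁,θ₁)) = ‖u₁‖²/(2θ₁) + (3/2)(θ₁⁻¹ - 1 + log θ₁)`
(`E_γ ‖v‖² = 3`, `E_γ ⟪u₁, v⟫ = 0`). [folklore] -/
theorem integral_llr1_stdGaussian {θ₁ : ℝ} (hθ₁ : 0 < θ₁) (u₁ : V3) :
    ∫ v, llr1 θ₁ u₁ v ∂stdGaussian V3 =
      ‖u₁‖ ^ 2 / (2 * θ₁) + 3 / 2 * (θ₁⁻¹ - 1 + Real.log θ₁) := by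
  have hpt : ∀ v : V3, llr1 θ₁ u₁ v = (3 / 2 * Real.log θ₁ + ‖u₁‖ ^ 2 / (2 * θ₁) +
      (θ₁⁻¹ - 1) / 2 * ‖v‖ ^ 2) + -(θ₁⁻¹ * ⟪u₁, v⟫_ℝ) := by
    intro v
    rw [llr1_eq hθ₁, norm_sub_sq_real, real_inner_comm]
    field_simp
    ring
  simp_rw [hpt]
  have h1 : Integrable (fun v : V3 => 3 / 2 * Real.log θ₁ + ‖u₁‖ ^ 2 / (2 * θ₁) +
      (θ₁⁻¹ - 1) / 2 * ‖v‖ ^ 2) (stdGaussian V3) :=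
    (integrable_const _).add (integrable_norm_sq_stdGaussian.const_mul _)
  have hi : Integrable (fun v : V3 => -(θ₁⁻¹ * ⟪u₁, v⟫_ℝ)) (stdGaussian V3) :=
    ((integrable_inner_stdGaussian u₁).const_mul _).neg
  rw [integral_add h1 hi, integral_add (integrable_const _) (integrable_norm_sq_stdGaussian.const_mul _),
    integral_const, integral_const_mul, integral_norm_sq_stdGaussian,
    integral_eq_zero_of_odd_stdGaussian (f := fun v : V3 => -(θ₁⁻¹ * ⟪u₁, v⟫_ℝ))
      (fun v => by rw [inner_neg_right]; ring)]
  simp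
  ring

/-- COST of the tilt: `∫ llr1 θ₁ u₁ (u₁ + √θ₁ w) dγ(w) = -KL(N(u₁,θ₁) ‖ N(0,1))
= -(‖u₁‖²/2 + (3/2)(θ₁ - 1 - log θ₁))` (both `integral_llr1_drift` and `integral_llr1_temp` at once).
[folklore] -/
theorem integral_llr1_comp_shift {θ₁ : ℝ} (hθ₁ : 0 < θ₁) (u₁ : V3) :
    ∫ w, llr1 θ₁ u₁ (u₁ + Real.sqrt θ₁ • w) ∂stdGaussian V3 =
      -(‖u₁‖ ^ 2 / 2 + 3 / 2 * (θ₁ - 1 - Real.log θ₁)) := by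
  have hpt : ∀ w : V3, llr1 θ₁ u₁ (u₁ + Real.sqrt θ₁ • w) =
      (3 / 2 * Real.log θ₁ - ‖u₁‖ ^ 2 / 2 + (1 - θ₁) / 2 * ‖w‖ ^ 2) + -(Real.sqrt θ₁ * ⟪u₁, w⟫_ℝ) := by
    intro w
    rw [llr1_eq hθ₁, add_sub_cancel_left, norm_add_sq_real, norm_smul, mul_pow, Real.norm_eq_abs,
      sq_abs, Real.sq_sqrt hθ₁.le, real_inner_smul_right]
    field_simp
    ring
  simp_rw [hpt]
  have h1 : Integrable (fun w : V3 => 3 / 2 * Real.log θ₁ - ‖u₁‖ ^ 2 / 2 + (1 - θ₁) / 2 * ‖w‖ ^ 2)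
      (stdGaussian V3) :=
    (integrable_const _).add (integrable_norm_sq_stdGaussian.const_mul _)
  have hi : Integrable (fun w : V3 => -(Real.sqrt θ₁ * ⟪u₁, w⟫_ℝ)) (stdGaussian V3) :=
    ((integrable_inner_stdGaussian u₁).const_mul _).neg
  rw [integral_add h1 hi,
    integral_add (integrable_const _) (integrable_norm_sq_stdGaussian.const_mul _), integral_const,
    integral_const_mul, integral_norm_sq_stdGaussian,
    integral_eq_zero_of_odd_stdGaussian (f := fun w : V3 => -(Real.sqrt θ₁ * ⟪u₁, w⟫_ℝ))
      (fun w => by rw [inner_neg_right]; ring)]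
  simp
  ring

/-- GAIN as a `γ`-integral: `∫ g(u₁ + √θ₁ w) dγ(w) = ∫ g · e^{-llr1 θ₁ u₁} dγ` — change of variables to
the tilted Gaussian (`integral_localMaxwellian_smul`), whose density is
`localMaxwellian 1 θ₁ u₁ = globalMaxwellian · e^{-llr1}` (`localMaxwellian_ref_eq`), and
`γ = globalMaxwellian dv`. No hypothesis on `g`. [folklore] -/
theorem integral_comp_shift_eq_integral_mul_exp_neg_llr1 {θ₁ : ℝ} (hθ₁ : 0 < θ₁) (u₁ : V3)
    (g : V3 → ℝ) :
    ∫ w, g (u₁ + Real.sqrt θ₁ • w) ∂stdGaussian V3 =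
      ∫ v, g v * Real.exp (-llr1 θ₁ u₁ v) ∂stdGaussian V3 := by
  rw [← integral_localMaxwellian_smul hθ₁ u₁ g, integral_stdGaussian_eq_integral_mul_globalMaxwellian,
    ← localMaxwellian_one_one_zero]
  refine integral_congr_ae (ae_of_all _ fun v => ?_)
  simp only [smul_eq_mul]
  rw [localMaxwellian_ref_eq hθ₁ u₁ v, Real.exp_neg, mul_assoc, mul_left_comm (Real.exp _),
    mul_inv_cancel₀ (Real.exp_pos _).ne', mul_one, mul_comm]

/-- `∫ e^{-llr1 θ₁ u₁} dγ = 1` (the tilted Gaussian is a probability measure). [folklore] -/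
theorem integral_exp_neg_llr1_stdGaussian {θ₁ : ℝ} (hθ₁ : 0 < θ₁) (u₁ : V3) :
    ∫ v, Real.exp (-llr1 θ₁ u₁ v) ∂stdGaussian V3 = 1 := by
  have h := integral_comp_shift_eq_integral_mul_exp_neg_llr1 hθ₁ u₁ fun _ => (1 : ℝ)
  simp only [one_mul, integral_const, probReal_univ, smul_eq_mul, mul_one] at h
  exact h.symm

/-- `e^{-llr1 θ₁ u₁}` is `γ`-integrable (its integral is `1 ≠ 0`). [folklore] -/
theorem integrable_exp_neg_llr1_stdGaussian {θ₁ : ℝ} (hθ₁ : 0 < θ₁) (u₁ : V3) :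
    Integrable (fun v => Real.exp (-llr1 θ₁ u₁ v)) (stdGaussian V3) := by
  by_contra h
  have h1 := integral_exp_neg_llr1_stdGaussian hθ₁ u₁
  rw [integral_undef h] at h1
  exact zero_ne_one h1

/-! ### The unprofitability theorem -/

/-- **Gibbs tilts are unprofitable at amplitude `1/4`.** For `g` continuous, `|g| ≤ 1/4`,
`g ⊥ span{1, v, |v|²}` in `L²(γ)`, every drift `u₁` and temperature `θ₁ > 0`:
`∫ (g + llr1 θ₁ u₁)(u₁ + √θ₁ w) dγ(w) = E_{N(u₁,θ₁)} g − KL(N(u₁,θ₁) ‖ N(0,1)) ≤ 0`. [folklore] -/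
theorem tiltFunctional_nonpos_of_abs_le_quarter {g : V3 → ℝ} (hg : Continuous g)
    (hgq : ∀ v, |g v| ≤ 1 / 4)
    (horth : ∀ (c₀ c₂ : ℝ) (b : V3),
      ∫ v, g v * (c₀ + inner ℝ b v + c₂ * ‖v‖ ^ 2) ∂(stdGaussian V3) = 0)
    (u₁ : V3) {θ₁ : ℝ} (hθ₁ : 0 < θ₁) :
    ∫ w, (g (u₁ + Real.sqrt θ₁ • w) + llr1 θ₁ u₁ (u₁ + Real.sqrt θ₁ • w)) ∂(stdGaussian V3) ≤ 0 := by
  rw [integral_add (integrable_comp_shift_of_abs_le hg hgq u₁ θ₁) (integrable_llr1_comp_shift hθ₁ u₁),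
    integral_llr1_comp_shift hθ₁ u₁]
  -- integrability bookkeeping under `γ`
  have hE := integrable_exp_neg_llr1_stdGaussian hθ₁ u₁
  have hL := integrable_llr1_stdGaussian hθ₁ u₁
  have hgm : AEStronglyMeasurable g (stdGaussian V3) := hg.aestronglyMeasurable
  have hgb : ∀ᵐ v ∂stdGaussian V3, ‖g v‖ ≤ 1 / 4 := ae_of_all _ fun v => by
    rw [Real.norm_eq_abs]; exact hgq v
  have hgE : Integrable (fun v => g v * Real.exp (-llr1 θ₁ u₁ v)) (stdGaussian V3) :=
    hE.bdd_mul hgm hgb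
  have h1L : Integrable (fun v => 1 - llr1 θ₁ u₁ v) (stdGaussian V3) := (integrable_const _).sub hL
  have hgL : Integrable (fun v => g v * (1 - llr1 θ₁ u₁ v)) (stdGaussian V3) := h1L.bdd_mul hgm hgb
  -- ORTHOGONALITY: `1 - llr1 ∈ span{1, v, |v|²}`
  have horth' : ∫ v, g v * (1 - llr1 θ₁ u₁ v) ∂stdGaussian V3 = 0 := by
    rw [← horth (1 - 3 / 2 * Real.log θ₁ - ‖u₁‖ ^ 2 / (2 * θ₁)) (1 / 2 - 1 / (2 * θ₁)) (θ₁⁻¹ • u₁)]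
    refine integral_congr_ae (ae_of_all _ fun v => ?_)
    simp only
    rw [llr1_eq hθ₁, norm_sub_sq_real, real_inner_smul_left, real_inner_comm]
    field_simp
    ring
  -- GAIN `≤ B/4`
  have hGB : ∫ w, g (u₁ + Real.sqrt θ₁ • w) ∂stdGaussian V3 ≤
      1 / 4 * (‖u₁‖ ^ 2 / (2 * θ₁) + 3 / 2 * (θ₁⁻¹ - 1 + Real.log θ₁)) := by
    calc ∫ w, g (u₁ + Real.sqrt θ₁ • w) ∂stdGaussian V3
        = ∫ v, (g v * Real.exp (-llr1 θ₁ u₁ v) - g v * (1 - llr1 θ₁ u₁ v)) ∂stdGaussian V3 := by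
          rw [integral_sub hgE hgL, horth', sub_zero]
          exact integral_comp_shift_eq_integral_mul_exp_neg_llr1 hθ₁ u₁ g
      _ ≤ ∫ v, 1 / 4 * (Real.exp (-llr1 θ₁ u₁ v) - (1 - llr1 θ₁ u₁ v)) ∂stdGaussian V3 := by
          refine integral_mono (hgE.sub hgL) ((hE.sub h1L).const_mul _) fun v => ?_
          have h0 : 0 ≤ Real.exp (-llr1 θ₁ u₁ v) - (1 - llr1 θ₁ u₁ v) := by
            have := Real.add_one_le_exp (-llr1 θ₁ u₁ v)
            linarith
          simp only
          rw [← mul_sub]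
          exact mul_le_mul_of_nonneg_right ((le_abs_self _).trans (hgq v)) h0
      _ = 1 / 4 * (‖u₁‖ ^ 2 / (2 * θ₁) + 3 / 2 * (θ₁⁻¹ - 1 + Real.log θ₁)) := by
          rw [integral_const_mul, integral_sub hE h1L, integral_sub (integrable_const _) hL,
            integral_exp_neg_llr1_stdGaussian hθ₁, integral_llr1_stdGaussian hθ₁, integral_const,
            probReal_univ, one_smul]
          ring
  -- GAIN `≤ 1/4`
  have hG4 : ∫ w, g (u₁ + Real.sqrt θ₁ • w) ∂stdGaussian V3 ≤ 1 / 4 := by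
    have h := integral_mono (integrable_comp_shift_of_abs_le hg hgq u₁ θ₁) (integrable_const (1 / 4))
      fun w => (le_abs_self _).trans (hgq (u₁ + Real.sqrt θ₁ • w))
    simpa using h
  -- REAL INEQUALITIES
  have hlog := Real.log_le_sub_one_of_pos hθ₁
  rcases le_total θ₁ (1 / 2) with h | h
  · -- `A ≥ (3/2)(log 2 - 1/2) > 1/4 ≥ G`
    have h2 : Real.log θ₁ ≤ 2 * θ₁ - 1 - Real.log 2 := by
      have := Real.log_le_sub_one_of_pos (by positivity : (0 : ℝ) < 2 * θ₁)
      rw [Real.log_mul two_ne_zero hθ₁.ne'] at this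
      linarith
    have := Real.log_two_gt_d9
    nlinarith [sq_nonneg ‖u₁‖]
  · -- `B ≤ 2A`
    have hq : θ₁⁻¹ - 1 + Real.log θ₁ ≤ 2 * (θ₁ - 1 - Real.log θ₁) := by
      rcases le_total θ₁ 1 with h1 | h1
      · have key := add_one_mul_log_le hθ₁ h1
        have hm : θ₁ * (θ₁⁻¹ - 1 + Real.log θ₁) ≤ θ₁ * (2 * (θ₁ - 1 - Real.log θ₁)) := by
          rw [mul_add, mul_sub, mul_inv_cancel₀ hθ₁.ne']
          nlinarith [mul_nonneg (sub_nonneg.2 hlog) (by linarith : (0 : ℝ) ≤ 2 * θ₁ - 1)]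
        exact le_of_mul_le_mul_left hm hθ₁
      · have key := two_mul_log_le h1
        linarith
    have hu : ‖u₁‖ ^ 2 / (2 * θ₁) ≤ ‖u₁‖ ^ 2 := div_le_self (sq_nonneg _) (by linarith)
    nlinarith [sq_nonneg ‖u₁‖]

/-- **The Disproof's near-miss `tiltFunctional_nonpos_of_admissible`, verbatim** (with `Orthogonal` and
`tiltFunctional` unfolded): there is an ABSOLUTE amplitude `κ₀ > 0` (here `κ₀ = 1/4`) such that for every
admissible observable of the crux (`g` continuous, `|g| ≤ κ₀`, `g ⊥ span{1, v, |v|²}`) the Gibbs-tilt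
functional is `≤ 0` for ALL drifts `u₁` and temperatures `θ₁ > 0`. [folklore] -/
theorem tiltFunctional_nonpos_of_admissible :
    ∃ κ₀ : ℝ, 0 < κ₀ ∧ ∀ (g : V3 → ℝ), Continuous g → (∀ v, |g v| ≤ κ₀) →
      (∀ (c₀ c₂ : ℝ) (b : V3),
        ∫ v, g v * (c₀ + inner ℝ b v + c₂ * ‖v‖ ^ 2) ∂(stdGaussian V3) = 0) →
      ∀ (u₁ : V3) (θ₁ : ℝ), 0 < θ₁ →
        ∫ w, (g (u₁ + Real.sqrt θ₁ • w) + llr1 θ₁ u₁ (u₁ + Real.sqrt θ₁ • w)) ∂(stdGaussian V3) ≤ 0 :=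
  ⟨1 / 4, by norm_num, fun _ hg hgq horth u₁ _ hθ₁ =>
    tiltFunctional_nonpos_of_abs_le_quarter hg hgq horth u₁ hθ₁⟩

/-! ### Quantitative form: the gain bound and a uniformly convex margin -/

/-- **The gain of a Gibbs tilt against an admissible observable.** For `g` continuous with `|g| ≤ κ` and
`g ⊥ span{1, v, |v|²}` in `L²(γ)`: `E_{N(u₁,θ₁)} g ≤ κ · KL(N(0,1) ‖ N(u₁,θ₁)) = κ · (‖u₁‖²/(2θ₁) + (3/2)(θ₁⁻¹ − 1 + log θ₁))`
(exact mechanism: `E_{M₁} g = E_γ[g (e^{−L} − 1 + L)]`, `L = llr1 θ₁ u₁ ∈ span{1, v, |v|²}`, `e^{−L} − 1 + L ≥ 0`,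
`E_γ[e^{−L} − 1 + L] = E_γ L`), together with the trivial bound `E_{N(u₁,θ₁)} g ≤ κ`. [folklore] -/
theorem integral_comp_shift_le_of_orthogonal {g : V3 → ℝ} (hg : Continuous g) {κ : ℝ}
    (hgκ : ∀ v, |g v| ≤ κ)
    (horth : ∀ (c₀ c₂ : ℝ) (b : V3),
      ∫ v, g v * (c₀ + inner ℝ b v + c₂ * ‖v‖ ^ 2) ∂(stdGaussian V3) = 0)
    (u₁ : V3) {θ₁ : ℝ} (hθ₁ : 0 < θ₁) :
    ∫ w, g (u₁ + Real.sqrt θ₁ • w) ∂stdGaussian V3 ≤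
        κ * (‖u₁‖ ^ 2 / (2 * θ₁) + 3 / 2 * (θ₁⁻¹ - 1 + Real.log θ₁)) ∧
      ∫ w, g (u₁ + Real.sqrt θ₁ • w) ∂stdGaussian V3 ≤ κ := by
  have hE := integrable_exp_neg_llr1_stdGaussian hθ₁ u₁
  have hL := integrable_llr1_stdGaussian hθ₁ u₁
  have hgm : AEStronglyMeasurable g (stdGaussian V3) := hg.aestronglyMeasurable
  have hgb : ∀ᵐ v ∂stdGaussian V3, ‖g v‖ ≤ κ := ae_of_all _ fun v => by
    rw [Real.norm_eq_abs]; exact hgκ v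
  have hgE : Integrable (fun v => g v * Real.exp (-llr1 θ₁ u₁ v)) (stdGaussian V3) :=
    hE.bdd_mul hgm hgb
  have h1L : Integrable (fun v => 1 - llr1 θ₁ u₁ v) (stdGaussian V3) := (integrable_const _).sub hL
  have hgL : Integrable (fun v => g v * (1 - llr1 θ₁ u₁ v)) (stdGaussian V3) := h1L.bdd_mul hgm hgb
  have horth' : ∫ v, g v * (1 - llr1 θ₁ u₁ v) ∂stdGaussian V3 = 0 := by
    rw [← horth (1 - 3 / 2 * Real.log θ₁ - ‖u₁‖ ^ 2 / (2 * θ₁)) (1 / 2 - 1 / (2 * θ₁)) (θ₁⁻¹ • u₁)]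
    refine integral_congr_ae (ae_of_all _ fun v => ?_)
    simp only
    rw [llr1_eq hθ₁, norm_sub_sq_real, real_inner_smul_left, real_inner_comm]
    field_simp
    ring
  refine ⟨?_, ?_⟩
  · calc ∫ w, g (u₁ + Real.sqrt θ₁ • w) ∂stdGaussian V3
        = ∫ v, (g v * Real.exp (-llr1 θ₁ u₁ v) - g v * (1 - llr1 θ₁ u₁ v)) ∂stdGaussian V3 := by
          rw [integral_sub hgE hgL, horth', sub_zero]
          exact integral_comp_shift_eq_integral_mul_exp_neg_llr1 hθ₁ u₁ g
      _ ≤ ∫ v, κ * (Real.exp (-llr1 θ₁ u₁ v) - (1 - llr1 θ₁ u₁ v)) ∂stdGaussian V3 := by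
          refine integral_mono (hgE.sub hgL) ((hE.sub h1L).const_mul _) fun v => ?_
          have h0 : 0 ≤ Real.exp (-llr1 θ₁ u₁ v) - (1 - llr1 θ₁ u₁ v) := by
            have := Real.add_one_le_exp (-llr1 θ₁ u₁ v)
            linarith
          simp only
          rw [← mul_sub]
          exact mul_le_mul_of_nonneg_right ((le_abs_self _).trans (hgκ v)) h0
      _ = κ * (‖u₁‖ ^ 2 / (2 * θ₁) + 3 / 2 * (θ₁⁻¹ - 1 + Real.log θ₁)) := by
          rw [integral_const_mul, integral_sub hE h1L, integral_sub (integrable_const _) hL,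
            integral_exp_neg_llr1_stdGaussian hθ₁, integral_llr1_stdGaussian hθ₁, integral_const,
            probReal_univ, one_smul]
          ring
  · have h := integral_mono (integrable_comp_shift_of_abs_le hg hgκ u₁ θ₁) (integrable_const κ)
      fun w => (le_abs_self _).trans (hgκ (u₁ + Real.sqrt θ₁ • w))
    simpa using h

/-- **Uniformly convex margin.** At amplitude `1/4` the Gibbs-tilt functional is not only `≤ 0` but
`≤ −(1/8) · KL(N(u₁,θ₁) ‖ N(0,1)) = −(1/8)(‖u₁‖²/2 + (3/2)(θ₁ − 1 − log θ₁))` for every drift and temperature: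
a profitable tilt of the crux's functional must stay a bounded KL-distance AWAY from every Gibbs law, uniformly.
(Case `θ₁ ≤ 1/2`: gain `≤ 1/4 ≤ (7/8)(3/2)(log 2 − 1/2) ≤ (7/8) KL`; case `θ₁ ≥ 1/2`: gain `≤ KL(γ‖M₁)/4 ≤ KL/2`.) [folklore] -/
theorem tiltFunctional_le_neg_kl_div_eight' {g : V3 → ℝ} (hg : Continuous g)
    (hgq : ∀ v, |g v| ≤ 1 / 4)
    (horth : ∀ (c₀ c₂ : ℝ) (b : V3),
      ∫ v, g v * (c₀ + inner ℝ b v + c₂ * ‖v‖ ^ 2) ∂(stdGaussian V3) = 0)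
    (u₁ : V3) {θ₁ : ℝ} (hθ₁ : 0 < θ₁) :
    ∫ w, (g (u₁ + Real.sqrt θ₁ • w) + llr1 θ₁ u₁ (u₁ + Real.sqrt θ₁ • w)) ∂(stdGaussian V3) ≤
      -(1 / 8) * (‖u₁‖ ^ 2 / 2 + 3 / 2 * (θ₁ - 1 - Real.log θ₁)) := by
  rw [integral_add (integrable_comp_shift_of_abs_le hg hgq u₁ θ₁) (integrable_llr1_comp_shift hθ₁ u₁),
    integral_llr1_comp_shift hθ₁ u₁]
  obtain ⟨hGB, hG4⟩ := integral_comp_shift_le_of_orthogonal hg hgq horth u₁ hθ₁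
  have hlog := Real.log_le_sub_one_of_pos hθ₁
  rcases le_total θ₁ (1 / 2) with h | h
  · have h2 : Real.log θ₁ ≤ 2 * θ₁ - 1 - Real.log 2 := by
      have := Real.log_le_sub_one_of_pos (by positivity : (0 : ℝ) < 2 * θ₁)
      rw [Real.log_mul two_ne_zero hθ₁.ne'] at this
      linarith
    have := Real.log_two_gt_d9
    nlinarith [sq_nonneg ‖u₁‖]
  · have hq : θ₁⁻¹ - 1 + Real.log θ₁ ≤ 2 * (θ₁ - 1 - Real.log θ₁) := by
      rcases le_total θ₁ 1 with h1 | h1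
      · have key := add_one_mul_log_le hθ₁ h1
        have hm : θ₁ * (θ₁⁻¹ - 1 + Real.log θ₁) ≤ θ₁ * (2 * (θ₁ - 1 - Real.log θ₁)) := by
          rw [mul_add, mul_sub, mul_inv_cancel₀ hθ₁.ne']
          nlinarith [mul_nonneg (sub_nonneg.2 hlog) (by linarith : (0 : ℝ) ≤ 2 * θ₁ - 1)]
        exact le_of_mul_le_mul_left hm hθ₁
      · have key := two_mul_log_le h1
        linarith
    have hu : ‖u₁‖ ^ 2 / (2 * θ₁) ≤ ‖u₁‖ ^ 2 := div_le_self (sq_nonneg _) (by linarith)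
    nlinarith [sq_nonneg ‖u₁‖]

/-- `tiltFunctional_le_neg_kl_div_eight'` in closed form (the registered sub-goal of the line's open stub, verbatim):
at amplitude `1/4` the Gibbs-tilt functional is `≤ −KL(N(u₁,θ₁) ‖ N(0,1))/8` for every drift and temperature. [folklore] -/
theorem tiltFunctional_le_neg_kl_div_eight : ∀ {g : V3 → ℝ}, Continuous g → (∀ v, |g v| ≤ 1 / 4) → (∀ (c₀ c₂ : ℝ) (b : V3), ∫ v, g v * (c₀ + inner ℝ b v + c₂ * ‖v‖ ^ 2) ∂(stdGaussian V3) = 0) → ∀ (u₁ : V3) {θ₁ : ℝ}, 0 < θ₁ → ∫ w, (g (u₁ + Real.sqrt θ₁ • w) + llr1 θ₁ u₁ (u₁ + Real.sqrt θ₁ • w)) ∂(stdGaussian V3) ≤ -(1 / 8) * (‖u₁‖ ^ 2 / 2 + 3 / 2 * (θ₁ - 1 - Real.log θ₁)) :=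
  fun hg hgq horth u₁ _ hθ₁ => tiltFunctional_le_neg_kl_div_eight' hg hgq horth u₁ hθ₁

end KineticFluxLdDecayTilt
end Summit.AtomisticToContinuum.HydrodynamicLimit.Theorems
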